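import Literature.MathematicalPhysics.QuantumFieldTheory.SU2PolyakovPairKernel
import Literature.MathematicalPhysics.QuantumFieldTheory.SU2OneLinkIntegrals
import Mathlib.Analysis.Convex.Integral
import Mathlib.Analysis.Convex.SpecificFunctions.Pow
import HarnessLib

/-!
# The two-link convolution formula on `SU(2)` and the transfer-matrix recursion step of
# Tomboulis–Yaffe (App. III): `h_a ∗ h_b = Φ(√(a² + b² + 2ab cos θ))`, Jensen, and the Gaussian merge bound

Tomboulis–Yaffe [TomboulisYaffe1985, §III (3.13)–(3.14) and App. III (A3.1)–(A3.5), pp. 323–324, 337–338]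
bound the `L_t`-th power of the transfer matrix `T` (3.12) by a "simple recursion relation": with the one-link weight
`h_β(V) = e^{β ½Re tr V}` one has (our normalisation; TY write `e^{β(½tr − 1)}`)

`(h_a ∗ h_b)(P) := ∫ dV h_a(P V⁻¹) h_b(V) = Φ(√(a² + b² + 2ab·½Re tr P))`,  `Φ(z) := ∫_{SU(2)} e^{z ½Re tr V} dV`

(`Φ(z) = I₁(z)·2/z`; "`I₁(z)` is a modified Bessel function", (3.14)), an EXACT formula (quaternions: `aP + b·1 = λ Û`,
`Û ∈ SU(2)`, `λ² = a² + b² + 2ab cos θ_P`), and Jensen's inequality `Φ(sz) ≤ Φ(z)^s` (`0 ≤ s ≤ 1`) turns it into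
the Gaussian-type MERGE BOUND

`(h_a ∗ h_b)(P) ≤ Φ(a+b) · exp{−[ab·ln Φ(a+b)/(a+b)²]·(1 − ½Re tr P)}`        (`a, b ≥ 0`, `a + b > 0`)

i.e. two consecutive Boltzmann factors of a ring merge into one of the same shape with the "renormalised coupling"
`b' = ab ln Φ(a+b)/(a+b)²` (TY's `β_>`, (3.14): "`β_> ∼ β_t/L_t + O(ln β_t)`") and the prefactor `Φ(a+b)`, which is SHARP
at `P = 1`.  This is the analytic step of the proof of the disorder bounds (R2(c) of the tree's
`NEEDS-TY85-DisorderBounds`); the ring recursion itself is carried out in `SU2TransferKernelBound.lean`.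

Proved here (no named facts): `htr` (`½Re tr`), `classExp` (`Φ`) with `classExp_pos`, `one_le_classExp`
(`Φ(z) = ∫cosh ≥ 1`, via `−1 ∈ SU(2)`), ★ `classExp_mul_le_rpow` (Jensen), ★ `integral_exp_htr_conv` (the two-link
formula), ★ `integral_exp_htr_conv_le` (the merge bound), and the size of `Φ` from the tree's one-link bounds
(`exp_le_classExp`, `classExp_le`).
-/

open MeasureTheory
open Literature.MathematicalPhysics.QuantumLattice (quatMatrix su2Quat quatToSU2 quatMatrix_su2Quat
  norm_su2Quat normSq_su2Quat coe_quatToSU2)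
open Literature.Computability.QuantumComplexity (SolovayKitaev.coe_inv)

namespace Literature.MathematicalPhysics.QuantumFieldTheory.SU2PairKernel

noncomputable section

/-! ### §1. `½Re tr` and the class function `Φ(z) = ∫ e^{z ½Re tr V} dV` -/

/-- `½ Re tr P = cos θ_P`, the class coordinate of `P ∈ SU(2)`. [cite: TomboulisYaffe1985, §III (3.17), p. 324] -/
def htr (P : (Matrix.specialUnitaryGroup (Fin 2) ℂ)) : ℝ := ((P : Matrix (Fin 2) (Fin 2) ℂ).trace.re) / 2

/-- `½Re tr P ∈ [−1, 1]`. [cite: TomboulisYaffe1985, §III (3.17), p. 324] -/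
theorem htr_mem_Icc (P : (Matrix.specialUnitaryGroup (Fin 2) ℂ)) : htr P ∈ Set.Icc (-1 : ℝ) 1 :=
  half_re_trace_mem_Icc P

/-- `½Re tr P = Re P₀₀` (the second diagonal entry is the conjugate of the first). [folklore] -/
private theorem htr_eq_re_apply (P : (Matrix.specialUnitaryGroup (Fin 2) ℂ)) :
    htr P = ((P : Matrix (Fin 2) (Fin 2) ℂ) 0 0).re := by
  rw [htr, Matrix.trace_fin_two, Literature.MathematicalPhysics.QuantumLattice.su2_apply_11, Complex.add_re,
    Complex.conj_re]
  ring

/-- `½Re tr P⁻¹ = ½Re tr P`. [folklore] -/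
private theorem htr_inv (P : (Matrix.specialUnitaryGroup (Fin 2) ℂ)) : htr P⁻¹ = htr P := by
  rw [htr, htr, SolovayKitaev.coe_inv, Matrix.star_eq_conjTranspose, Matrix.trace_conjTranspose,
    Complex.star_def, Complex.conj_re]

/-- `½Re tr` is continuous. [folklore] -/
private theorem continuous_htr : Continuous htr :=
  (Complex.continuous_re.comp (continuous_subtype_val.matrix_trace)).div_const _

/-- `Φ(z) = ∫_{SU(2)} e^{z ½Re tr V} dV` (`= 2I₁(z)/z`), the class-function generating the two-link formula.
[cite: TomboulisYaffe1985, §III (3.14), p. 324] -/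
def classExp (z : ℝ) : ℝ :=
  ∫ V, Real.exp (z * htr V) ∂(QuantumFieldTheory.haarProbability (Matrix.specialUnitaryGroup (Fin 2) ℂ))

/-- `Φ(z)` in the tree's one-link normalisation `∫ e^{B Re tr V} dV`, `B = z/2`. [cite: TomboulisYaffe1985, §III (3.14), p. 324] -/
theorem classExp_eq_integral_exp_mul_re_trace (z : ℝ) :
    classExp z = ∫ V, Real.exp (z / 2 * ((V : Matrix (Fin 2) (Fin 2) ℂ).trace.re))
      ∂(QuantumFieldTheory.haarProbability (Matrix.specialUnitaryGroup (Fin 2) ℂ)) := by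
  unfold classExp htr
  refine integral_congr_ae (Filter.Eventually.of_forall fun V => ?_)
  simp only
  ring_nf

/-- The integrand of `Φ` is continuous. [folklore] -/
private theorem continuous_exp_mul_htr (z : ℝ) :
    Continuous fun V : (Matrix.specialUnitaryGroup (Fin 2) ℂ) => Real.exp (z * htr V) :=
  Real.continuous_exp.comp (continuous_const.mul continuous_htr)

/-- The integrand of `Φ` is integrable. [folklore] -/
private theorem integrable_exp_mul_htr (z : ℝ) :
    Integrable (fun V : (Matrix.specialUnitaryGroup (Fin 2) ℂ) => Real.exp (z * htr V))
      (QuantumFieldTheory.haarProbability (Matrix.specialUnitaryGroup (Fin 2) ℂ)) :=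
  (continuous_exp_mul_htr z).integrable_of_hasCompactSupport (HasCompactSupport.of_compactSpace _)

/-- `Φ(z) ≥ e^{−|z|} > 0`. [cite: TomboulisYaffe1985, §III (3.14), p. 324] -/
theorem exp_neg_abs_le_classExp (z : ℝ) : Real.exp (-|z|) ≤ classExp z := by
  have h : ∫ _V, Real.exp (-|z|) ∂(QuantumFieldTheory.haarProbability (Matrix.specialUnitaryGroup (Fin 2) ℂ)) =
      Real.exp (-|z|) := by simp
  rw [classExp, ← h]
  refine integral_mono (integrable_const _) (integrable_exp_mul_htr z) fun V => ?_
  refine Real.exp_le_exp.mpr ?_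
  have h1 := (htr_mem_Icc V).1
  have h2 := (htr_mem_Icc V).2
  cases le_or_gt 0 z with
  | inl hz => rw [abs_of_nonneg hz]; nlinarith
  | inr hz => rw [abs_of_neg hz]; nlinarith

/-- `Φ(z) > 0`. [cite: TomboulisYaffe1985, §III (3.14), p. 324] -/
theorem classExp_pos (z : ℝ) : 0 < classExp z := lt_of_lt_of_le (Real.exp_pos _) (exp_neg_abs_le_classExp z)

/-- `−1 ∈ SU(2)`. [folklore] -/
private theorem neg_one_mem : (-1 : Matrix (Fin 2) (Fin 2) ℂ) ∈ Matrix.specialUnitaryGroup (Fin 2) ℂ := by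
  rw [Matrix.mem_specialUnitaryGroup_iff]
  refine ⟨?_, by simp [Matrix.det_neg, Matrix.det_one]⟩
  rw [Matrix.mem_unitaryGroup_iff']
  simp

/-- `Φ` is even: `Φ(−z) = Φ(z)` (substitute `V ↦ −V`). [folklore] -/
private theorem classExp_neg (z : ℝ) : classExp (-z) = classExp z := by
  set m : (Matrix.specialUnitaryGroup (Fin 2) ℂ) := ⟨-1, neg_one_mem⟩ with hm
  have h := integral_mul_left_eq_self (μ := QuantumFieldTheory.haarProbability (Matrix.specialUnitaryGroup (Fin 2) ℂ))
    (fun V : (Matrix.specialUnitaryGroup (Fin 2) ℂ) => Real.exp (z * htr V)) m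
  rw [classExp, classExp, ← h]
  refine integral_congr_ae (Filter.Eventually.of_forall fun V => ?_)
  have hV : htr (m * V) = -htr V := by
    simp only [htr, Submonoid.coe_mul, hm, neg_mul, one_mul, Matrix.trace_neg, Complex.neg_re]
    ring
  simp only [hV]
  ring_nf

/-- **`Φ(z) ≥ 1`**: `Φ(z) = ∫ cosh(z ½Re tr V) dV` by the symmetry `V ↦ −V`. [cite: TomboulisYaffe1985, §III (3.14), p. 324] -/
theorem one_le_classExp (z : ℝ) : 1 ≤ classExp z := by
  have h2 : 2 * classExp z = ∫ V, (Real.exp (z * htr V) + Real.exp (-z * htr V))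
      ∂(QuantumFieldTheory.haarProbability (Matrix.specialUnitaryGroup (Fin 2) ℂ)) := by
    rw [integral_add (integrable_exp_mul_htr z) (integrable_exp_mul_htr (-z)), two_mul]
    congr 1
    exact (classExp_neg z).symm
  have h3 : ∫ _V, (2 : ℝ) ∂(QuantumFieldTheory.haarProbability (Matrix.specialUnitaryGroup (Fin 2) ℂ)) ≤
      ∫ V, (Real.exp (z * htr V) + Real.exp (-z * htr V))
        ∂(QuantumFieldTheory.haarProbability (Matrix.specialUnitaryGroup (Fin 2) ℂ)) := by
    refine integral_mono (integrable_const _) ((integrable_exp_mul_htr z).add (integrable_exp_mul_htr (-z)))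
      fun V => ?_
    have := Real.add_one_le_exp (z * htr V)
    have := Real.add_one_le_exp (-z * htr V)
    have hc : Real.exp (z * htr V) * Real.exp (-z * htr V) = 1 := by rw [← Real.exp_add]; simp
    nlinarith [Real.exp_pos (z * htr V), Real.exp_pos (-z * htr V), sq_nonneg (Real.exp (z * htr V) - Real.exp (-z * htr V))]
  have h4 : ∫ _V, (2 : ℝ) ∂(QuantumFieldTheory.haarProbability (Matrix.specialUnitaryGroup (Fin 2) ℂ)) = 2 := by simp
  linarith

/-- **Jensen for `Φ`**: `Φ(sz) ≤ Φ(z)^s` for `0 ≤ s ≤ 1` (concavity of `x ↦ x^s`; TY App. III use the convexity of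
`ln Φ` instead). [cite: TomboulisYaffe1985, App. III (A3.1)–(A3.5), pp. 337–338] -/
theorem classExp_mul_le_rpow {s : ℝ} (hs0 : 0 ≤ s) (hs1 : s ≤ 1) (z : ℝ) :
    classExp (s * z) ≤ classExp z ^ s := by
  have hJ := ConcaveOn.le_map_integral
    (μ := QuantumFieldTheory.haarProbability (Matrix.specialUnitaryGroup (Fin 2) ℂ))
    (f := fun V : (Matrix.specialUnitaryGroup (Fin 2) ℂ) => Real.exp (z * htr V))
    (Real.concaveOn_rpow hs0 hs1) (continuousOn_id.rpow_const fun x _ => Or.inr hs0) isClosed_Ici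
    (Filter.Eventually.of_forall fun V => (Real.exp_pos _).le) (integrable_exp_mul_htr z) ?_
  · refine le_trans (le_of_eq ?_) hJ
    unfold classExp
    refine integral_congr_ae (Filter.Eventually.of_forall fun V => ?_)
    simp only
    rw [← Real.exp_mul]; ring_nf
  · have : (fun x : ℝ => x ^ s) ∘ (fun V : (Matrix.specialUnitaryGroup (Fin 2) ℂ) => Real.exp (z * htr V)) =
        fun V => Real.exp ((s * z) * htr V) := by
      funext V; simp only [Function.comp_apply]; rw [← Real.exp_mul]; ring_nf
    rw [this]
    exact integrable_exp_mul_htr _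

/-- **Size of `Φ`, lower half**: `(8/3eπ³)·e^{z}/((z/2)√(z/2)) ≤ Φ(z)` for `z ≥ 2` (the tree's
`exp_div_le_integral_exp_mul_re_trace`). [cite: TomboulisYaffe1985, §III (3.14), p. 324] -/
theorem exp_div_le_classExp {z : ℝ} (hz : 2 ≤ z) :
    8 / (3 * Real.exp 1 * Real.pi ^ 3) * (Real.exp z / (z / 2 * Real.sqrt (z / 2))) ≤ classExp z := by
  have h := SU2OneLink.exp_div_le_integral_exp_mul_re_trace (B := z / 2) (by linarith)
  rw [show 2 * (z / 2) = z by ring] at h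
  rw [classExp_eq_integral_exp_mul_re_trace]
  exact h

/-- **Size of `Φ`, upper half**: `Φ(z) ≤ (π²√π/16)·e^{z}/((z/2)√(z/2))` for `z > 0` (the tree's
`integral_exp_mul_re_trace_le`). [cite: TomboulisYaffe1985, §III (3.14), p. 324] -/
theorem classExp_le {z : ℝ} (hz : 0 < z) :
    classExp z ≤ Real.pi ^ 2 * Real.sqrt Real.pi / 16 * (Real.exp z / (z / 2 * Real.sqrt (z / 2))) := by
  have h := SU2OneLink.integral_exp_mul_re_trace_le (B := z / 2) (by linarith)
  rw [show 2 * (z / 2) = z by ring] at h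
  rw [classExp_eq_integral_exp_mul_re_trace]
  exact h

/-! ### §2. The two-link convolution formula -/

/-- `quatMatrix` is additive. [folklore] -/
private theorem quatMatrix_add (p q : Quaternion ℝ) : quatMatrix (p + q) = quatMatrix p + quatMatrix q := by
  ext i j
  fin_cases i <;> fin_cases j <;> apply Complex.ext <;> simp [quatMatrix] <;> ring

/-- `quatMatrix` of a real quaternion is the scalar matrix. [folklore] -/
private theorem quatMatrix_coe (b : ℝ) : quatMatrix (b : Quaternion ℝ) = (b : ℂ) • (1 : Matrix (Fin 2) (Fin 2) ℂ) := by
  ext i j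
  fin_cases i <;> fin_cases j <;> apply Complex.ext <;> simp [quatMatrix]

/-- The affine combination `aP + b·1` of `P ∈ SU(2)` is the matrix of the quaternion `a·q_P + b`. [folklore] -/
private theorem smul_add_smul_one_eq_quatMatrix (a b : ℝ) (P : (Matrix.specialUnitaryGroup (Fin 2) ℂ)) :
    (a : ℂ) • (P : Matrix (Fin 2) (Fin 2) ℂ) + (b : ℂ) • (1 : Matrix (Fin 2) (Fin 2) ℂ) =
      quatMatrix (a • su2Quat P + (b : Quaternion ℝ)) := by
  rw [quatMatrix_add, Literature.MathematicalPhysics.QuantumLattice.quatMatrix_smul, quatMatrix_su2Quat,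
    quatMatrix_coe]

/-- `‖a q_P + b‖² = a² + b² + 2ab·½Re tr P`. [folklore] -/
private theorem normSq_smul_su2Quat_add (a b : ℝ) (P : (Matrix.specialUnitaryGroup (Fin 2) ℂ)) :
    Quaternion.normSq (a • su2Quat P + (b : Quaternion ℝ)) = a ^ 2 + b ^ 2 + 2 * a * b * htr P := by
  have h1 := normSq_su2Quat P
  have hre : (su2Quat P).re = htr P := by rw [htr_eq_re_apply]; rfl
  have hx : a • su2Quat P + (b : Quaternion ℝ) =
      ⟨a * (su2Quat P).re + b, a * (su2Quat P).imI, a * (su2Quat P).imJ, a * (su2Quat P).imK⟩ := by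
    ext <;> simp
  rw [hx, Quaternion.normSq_def']
  rw [Quaternion.normSq_def'] at h1
  simp only [su2Quat] at h1 hre ⊢
  rw [← hre]
  nlinarith [h1]

/-- `‖a q_P + b‖ = √(a² + b² + 2ab·½Re tr P)`. [folklore] -/
private theorem norm_smul_su2Quat_add (a b : ℝ) (P : (Matrix.specialUnitaryGroup (Fin 2) ℂ)) :
    ‖a • su2Quat P + (b : Quaternion ℝ)‖ = Real.sqrt (a ^ 2 + b ^ 2 + 2 * a * b * htr P) := by
  rw [← normSq_smul_su2Quat_add, Quaternion.normSq_eq_norm_mul_self, Real.sqrt_mul_self (norm_nonneg _)]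

/-- The exponent identity: `a·½Re tr(P V⁻¹) + b·½Re tr V = ½Re tr((aP + b·1)V⁻¹)`. [folklore] -/
private theorem htr_affine (a b : ℝ) (P V : (Matrix.specialUnitaryGroup (Fin 2) ℂ)) :
    a * htr (P * V⁻¹) + b * htr V =
      ((((a : ℂ) • (P : Matrix (Fin 2) (Fin 2) ℂ) + (b : ℂ) • (1 : Matrix (Fin 2) (Fin 2) ℂ)) *
        ((V⁻¹ : (Matrix.specialUnitaryGroup (Fin 2) ℂ)) : Matrix (Fin 2) (Fin 2) ℂ)).trace.re) / 2 := by
  rw [← htr_inv V]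
  simp only [htr, Submonoid.coe_mul, add_mul, Matrix.smul_mul, one_mul, Matrix.trace_add, Matrix.trace_smul,
    Complex.add_re, smul_eq_mul, Complex.re_ofReal_mul]
  ring

/-- **THE TWO-LINK CONVOLUTION FORMULA on `SU(2)`**: for all real `a, b` and `P ∈ SU(2)`,
`∫ dV e^{a ½Re tr(P V⁻¹)} e^{b ½Re tr V} = Φ(√(a² + b² + 2ab ½Re tr P))`
(write `aP + b·1 = λÛ` with `Û ∈ SU(2)`, `λ = ‖a q_P + b‖`, and use the invariance of Haar measure).
[cite: TomboulisYaffe1985, App. III (A3.1)–(A3.3), p. 337] -/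
theorem integral_exp_htr_conv (a b : ℝ) (P : (Matrix.specialUnitaryGroup (Fin 2) ℂ)) :
    ∫ V, Real.exp (a * htr (P * V⁻¹)) * Real.exp (b * htr V)
        ∂(QuantumFieldTheory.haarProbability (Matrix.specialUnitaryGroup (Fin 2) ℂ)) =
      classExp (Real.sqrt (a ^ 2 + b ^ 2 + 2 * a * b * htr P)) := by
  set x : Quaternion ℝ := a • su2Quat P + (b : Quaternion ℝ) with hx
  rw [← norm_smul_su2Quat_add, ← hx]
  by_cases hx0 : x = 0
  · -- degenerate case `aP + b = 0`: both sides are `1`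
    have hint : ∀ V : (Matrix.specialUnitaryGroup (Fin 2) ℂ), a * htr (P * V⁻¹) + b * htr V = 0 := by
      intro V
      rw [htr_affine, smul_add_smul_one_eq_quatMatrix, ← hx, hx0, ← Quaternion.coe_zero, quatMatrix_coe]
      simp
    rw [hx0, norm_zero, classExp]
    refine integral_congr_ae (Filter.Eventually.of_forall fun V => ?_)
    simp only
    rw [← Real.exp_add, hint V, zero_mul]
  · -- `aP + b·1 = ‖x‖ · Û`
    set U : (Matrix.specialUnitaryGroup (Fin 2) ℂ) := quatToSU2 x with hU
    have hM : (a : ℂ) • (P : Matrix (Fin 2) (Fin 2) ℂ) + (b : ℂ) • (1 : Matrix (Fin 2) (Fin 2) ℂ) =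
        (‖x‖ : ℂ) • (U : Matrix (Fin 2) (Fin 2) ℂ) := by
      rw [smul_add_smul_one_eq_quatMatrix, ← hx, hU, coe_quatToSU2 hx0,
        Literature.MathematicalPhysics.QuantumLattice.quatMatrix_smul, smul_smul]
      have : (‖x‖ : ℂ) * (‖x‖⁻¹ : ℝ) = 1 := by
        rw [Complex.ofReal_inv, mul_inv_cancel₀]
        exact_mod_cast norm_ne_zero_iff.mpr hx0
      rw [this, one_smul]
    have hint : ∀ V : (Matrix.specialUnitaryGroup (Fin 2) ℂ),
        a * htr (P * V⁻¹) + b * htr V = ‖x‖ * htr (U * V⁻¹) := by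
      intro V
      rw [htr_affine, hM, htr, Submonoid.coe_mul, Matrix.smul_mul, Matrix.trace_smul, smul_eq_mul,
        Complex.re_ofReal_mul]
      ring
    have h1 : (fun V : (Matrix.specialUnitaryGroup (Fin 2) ℂ) => Real.exp (a * htr (P * V⁻¹)) * Real.exp (b * htr V)) =
        fun V => (fun W : (Matrix.specialUnitaryGroup (Fin 2) ℂ) => Real.exp (‖x‖ * htr (U * W))) V⁻¹ := by
      funext V; simp only; rw [← Real.exp_add, hint V]
    rw [h1, integral_inv_eq_self (fun W : (Matrix.specialUnitaryGroup (Fin 2) ℂ) => Real.exp (‖x‖ * htr (U * W))),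
      integral_mul_left_eq_self (fun W : (Matrix.specialUnitaryGroup (Fin 2) ℂ) => Real.exp (‖x‖ * htr W)) U]
    rfl

/-! ### §3. The merge bound (Jensen) -/

/-- `λ = √(a²+b²+2abc) ≤ a + b` and `(a+b) − λ ≥ ab(1−c)/(a+b)` for `a, b ≥ 0`, `a + b > 0`, `c ≤ 1`. [folklore] -/
private theorem sqrt_affine_bounds {a b c : ℝ} (ha : 0 ≤ a) (hb : 0 ≤ b) (hab : 0 < a + b) (hc : c ≤ 1) (hc' : -1 ≤ c) :
    Real.sqrt (a ^ 2 + b ^ 2 + 2 * a * b * c) ≤ a + b ∧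
      a * b * (1 - c) / (a + b) ≤ (a + b) - Real.sqrt (a ^ 2 + b ^ 2 + 2 * a * b * c) := by
  set l := Real.sqrt (a ^ 2 + b ^ 2 + 2 * a * b * c) with hl
  have hrad : 0 ≤ a ^ 2 + b ^ 2 + 2 * a * b * c := by
    have h1 : -(2 * a * b) ≤ 2 * a * b * c := by nlinarith [mul_nonneg ha hb]
    nlinarith [sq_nonneg (a - b)]
  have hl0 : 0 ≤ l := Real.sqrt_nonneg _
  have hl2 : l ^ 2 = a ^ 2 + b ^ 2 + 2 * a * b * c := Real.sq_sqrt hrad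
  have hle : l ≤ a + b := by nlinarith [mul_nonneg ha hb]
  refine ⟨hle, ?_⟩
  rw [div_le_iff₀ hab]
  nlinarith [mul_nonneg ha hb, mul_nonneg (mul_nonneg ha hb) (sub_nonneg.mpr hc)]

/-- **THE MERGE BOUND** (TY's recursion (3.13)–(3.14)/(A3.4)–(A3.5) in Gaussian form): for `a, b ≥ 0` with `a + b > 0`
and every `P ∈ SU(2)`,
`∫ dV e^{a ½Re tr(PV⁻¹)} e^{b ½Re tr V} ≤ Φ(a+b) · exp{−[ab ln Φ(a+b)/(a+b)²] (1 − ½Re tr P)}`: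
two consecutive ring factors merge into one of the same shape, with renormalised coupling `ab ln Φ(a+b)/(a+b)²` and a
prefactor that is exact at `P = 1`. [cite: TomboulisYaffe1985, §III (3.13)–(3.14), p. 324; App. III (A3.4)–(A3.5), p. 338] -/
theorem integral_exp_htr_conv_le {a b : ℝ} (ha : 0 ≤ a) (hb : 0 ≤ b) (hab : 0 < a + b)
    (P : (Matrix.specialUnitaryGroup (Fin 2) ℂ)) :
    ∫ V, Real.exp (a * htr (P * V⁻¹)) * Real.exp (b * htr V)
        ∂(QuantumFieldTheory.haarProbability (Matrix.specialUnitaryGroup (Fin 2) ℂ)) ≤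
      classExp (a + b) * Real.exp (-(a * b * Real.log (classExp (a + b)) / (a + b) ^ 2) * (1 - htr P)) := by
  rw [integral_exp_htr_conv]
  set l := Real.sqrt (a ^ 2 + b ^ 2 + 2 * a * b * htr P) with hl
  obtain ⟨hle, hgap⟩ := sqrt_affine_bounds ha hb hab (htr_mem_Icc P).2 (htr_mem_Icc P).1
  have hl0 : 0 ≤ l := Real.sqrt_nonneg _
  have hΦ := classExp_pos (a + b)
  have hlog : 0 ≤ Real.log (classExp (a + b)) := Real.log_nonneg (one_le_classExp _)
  -- Jensen with `s = l/(a+b)`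
  have hs0 : 0 ≤ l / (a + b) := div_nonneg hl0 hab.le
  have hs1 : l / (a + b) ≤ 1 := (div_le_one hab).mpr hle
  have hJ := classExp_mul_le_rpow hs0 hs1 (a + b)
  rw [div_mul_cancel₀ l hab.ne'] at hJ
  refine hJ.trans ?_
  rw [Real.rpow_def_of_pos hΦ, ← Real.log_le_log_iff (Real.exp_pos _) (mul_pos hΦ (Real.exp_pos _)),
    Real.log_exp, Real.log_mul hΦ.ne' (Real.exp_pos _).ne', Real.log_exp]
  -- `log Φ · (l/(a+b)) ≤ log Φ − [ab log Φ/(a+b)²](1 − c)`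
  have key : a * b * Real.log (classExp (a + b)) / (a + b) ^ 2 * (1 - htr P) ≤
      Real.log (classExp (a + b)) * (1 - l / (a + b)) := by
    have h1 : 1 - l / (a + b) = ((a + b) - l) / (a + b) := by field_simp
    rw [h1]
    have h2 : a * b * (1 - htr P) / (a + b) / (a + b) ≤ ((a + b) - l) / (a + b) :=
      div_le_div_of_nonneg_right hgap hab.le
    calc a * b * Real.log (classExp (a + b)) / (a + b) ^ 2 * (1 - htr P)
        = Real.log (classExp (a + b)) * (a * b * (1 - htr P) / (a + b) / (a + b)) := by
          field_simp
      _ ≤ Real.log (classExp (a + b)) * (((a + b) - l) / (a + b)) := mul_le_mul_of_nonneg_left h2 hlog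
  nlinarith [key]

end

end Literature.MathematicalPhysics.QuantumFieldTheory.SU2PairKernel
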